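import Literature.NumberTheory.LocalFields.UnramifiedQuadraticOrderLattices     -- ★ p840815/p840883 (B-p04): MARS' lattice lemma `Λ = z·R_E(j)`
import Literature.NumberTheory.LocalFields.UnramifiedQuadraticOrderUnitIndex    -- ★ p840757 (F3a): `R_E(j) = R^σ + 𝔪^j`
import HarnessLib

/-!
# `GL₂(F) = ⊔_{j ≥ 0} ι(E^×) · diag(1, ϖ^j) · GL₂(𝒪_F)` — Mars' lattice lemma in matrix dress (σ-form)
(Flicker (1998), *Elementary proof of the fundamental lemma for a unitary group*, REMARK p. 84 «`GL(V) = ⋃_{j ≥ 0} E^× d_j K`, `d_j = diag(1, π^j)`»,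
the engine of Prop. 6 p. 83)

Topic `NumberTheory/LocalFields`; namespace `Literature.NumberTheory.LocalFields.UnramifiedQuadraticNorm` (B-p10 (g24) ∕ B-p04 (g33)'s σ-form frame: `R` a DVR
with an involution `σ`, `R^σ` the fixed ring, `a ∈ R` with `σa − a` a unit — the model is `R = 𝒪_w ⊃ R^σ = 𝒪_v` at an inert place).  KERNEL mathematics only:
theorems, no definition, no named fact, no instance, no notation, no `sorry`.  Cell `pub/hodgecm-mathlib`, programme P3a, road «D-N7-inert», MAP v3 «N7-ns
COUNT FROM FLICKER», brick (F3c-γ) «LATTICE ↔ COSET TRANSPORT» FILE γ1 (LEAD F0P3a-plan (g9) T8-60 (C); architect A-p06 (g26)).  HC_CM is proved only modulo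
the printed citations (2 remaining named inputs hLiu418, h413) until rung 0 closes; this file discharges no named fact.

MATHEMATICS.  Read a `σ`-fixed `2 × 2` matrix `g` over `R` with `det g ≠ 0` (an element of `GL₂(F) ∩ M₂(𝒪_F)`, `F = Frac R^σ`) through the basis `(1, a)` of
`R` over `R^σ` (★ `uCoord`∕`vCoord`): its columns are `c_i = g₀ᵢ + g₁ᵢ·a ∈ R`, spanning an `R^σ`-lattice `Λ_g ⊂ R` of rank `2` (§1).  MARS (★
`exists_forall_mem_iff_exists_map_sub_self_mem_pow_and_eq_mul`): `Λ_g = z · R_E(j)`, `R_E(j) = {y : σy − y ∈ 𝔪^j} = R^σ ⊕ ϖ^j R^σ a`.  Comparing the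
`R^σ`-bases `(c₀, c₁)` and `(z, z ϖ^j a)` of `Λ_g`: **`g = ι(z) · diag(1, ϖ^j) · k`, `k ∈ GL₂(R^σ)`** (§2), where `ι(u + v a) = (u, −v·aσa; v, u + v(a+σa))`
is multiplication by `z` in the basis `(1, a)` (`a² = (a + σa)a − aσa`).  Stated in COORDINATES (no matrix product in the head; the four entry identities)
so that the `U(Φ₃)`-side transport (γ2) rewrites entrywise.

References: [Flicker1998UnitaryFL] Y. Z. Flicker, Canad. J. Math. 50 (1998), REMARK p. 84, Prop. 6 p. 83 · [Serre1979] J.-P. Serre, *Local Fields*, GTM 67,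
Ch. V §2 Prop. 2 (the basis `(1, a)` of an unramified quadratic ring extension). -/

set_option autoImplicit false

namespace Literature.NumberTheory.LocalFields.UnramifiedQuadraticNorm

open IsLocalRing

universe u

variable {R : Type u} [CommRing R] (σ : R →+* R)

/-! ## §0 Coordinates in the basis `(1, a)` -/

/-- Multiplication by `z = u + v·a` in the basis `(1, a)`: `(u + v a)(x + y a) = (u x − v·(aσa)·y) + (v x + (u + v(a + σa)) y)·a`
(`a² = (a+σa)·a − a·σa`). [cite: Serre1979, Ch. V §2 Prop. 2] -/
theorem mul_coords (a u v x y : R) :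
    (u + v * a) * (x + y * a) = (u * x - v * (a * σ a) * y) + (v * x + (u + v * (a + σ a)) * y) * a := by ring

/-- Both coordinates are unique: `p + q a = p′ + q′ a` with `σ`-fixed `p q p′ q′` forces `p = p′`, `q = q′`. [cite: Serre1979, Ch. V §2 Prop. 2] -/
theorem coords_unique {a : R} (ha : IsUnit (σ a - a)) {p q p' q' : R} (hp : σ p = p) (hq : σ q = q) (hp' : σ p' = p') (hq' : σ q' = q')
    (h : p + q * a = p' + q' * a) : p = p' ∧ q = q' := by
  have hqq : q = q' := vCoord_unique σ ha hp hq hp' hq' h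
  refine ⟨?_, hqq⟩
  rw [hqq] at h
  exact add_right_cancel h

/-! ## §1 The lattice of a `σ`-fixed `2 × 2` matrix -/

section Indep

variable [IsDomain R] {a : R}

/-- `R^σ`-independence of the columns `c_i = g₀ᵢ + g₁ᵢ a` when `det g ≠ 0`: `p c₀ + q c₁ = 0` with `σ`-fixed `p, q` forces `p = q = 0`.
[cite: Flicker1998UnitaryFL, REMARK p. 84] -/
theorem coords_indep (ha : IsUnit (σ a - a)) {g : Matrix (Fin 2) (Fin 2) R} (hg : ∀ i j, σ (g i j) = g i j) (hdet : g 0 0 * g 1 1 - g 0 1 * g 1 0 ≠ 0)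
    {p q : R} (hp : σ p = p) (hq : σ q = q) (h : p * (g 0 0 + g 1 0 * a) + q * (g 0 1 + g 1 1 * a) = 0) : p = 0 ∧ q = 0 := by
  have h' : (p * g 0 0 + q * g 0 1) + (p * g 1 0 + q * g 1 1) * a = 0 + 0 * a := by rw [zero_mul, add_zero, ← h]; ring
  have hfix1 : σ (p * g 0 0 + q * g 0 1) = p * g 0 0 + q * g 0 1 := by rw [map_add, map_mul, map_mul, hp, hq, hg, hg]
  have hfix2 : σ (p * g 1 0 + q * g 1 1) = p * g 1 0 + q * g 1 1 := by rw [map_add, map_mul, map_mul, hp, hq, hg, hg]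
  obtain ⟨e1, e2⟩ := coords_unique σ ha hfix1 hfix2 (map_zero σ) (map_zero σ) h'
  have hp0 : (g 0 0 * g 1 1 - g 0 1 * g 1 0) * p = 0 := by linear_combination g 1 1 * e1 - g 0 1 * e2
  have hq0 : (g 0 0 * g 1 1 - g 0 1 * g 1 0) * q = 0 := by linear_combination g 0 0 * e2 - g 1 0 * e1
  exact ⟨(mul_eq_zero.1 hp0).resolve_left hdet, (mul_eq_zero.1 hq0).resolve_left hdet⟩

end Indep

section Main

variable [IsDomain R] [IsDiscreteValuationRing R] (hσ : ∀ a, σ (σ a) = a) {a : R} (ha : IsUnit (σ a - a))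

include hσ ha in
/-- `R_E(j) = R^σ ⊕ ϖ^j R^σ·a` in coordinates: `σy − y ∈ 𝔪^j` iff `y = U + ϖ^j·W·a` with `σ`-fixed `U, W`. [cite: Flicker1998UnitaryFL, REMARK p. 84] -/
theorem exists_coords_of_map_sub_self_mem_pow {ϖ : R} (hϖ : Irreducible ϖ) (hσϖ : σ ϖ = ϖ) {j : ℕ} {y : R}
    (hy : σ y - y ∈ maximalIdeal R ^ j) : ∃ U W : R, σ U = U ∧ σ W = W ∧ y = U + ϖ ^ j * W * a := by
  obtain ⟨r, hr, hyr⟩ := (map_sub_self_mem_pow_iff_exists_fixed σ hσ ha j y).1 hy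
  rw [Irreducible.maximalIdeal_eq hϖ, Ideal.span_singleton_pow, Ideal.mem_span_singleton'] at hyr
  obtain ⟨t, ht⟩ := hyr
  -- `t = u_t + v_t a`
  refine ⟨r + ϖ ^ j * (t - (σ t - t) * ↑(ha.unit⁻¹) * a), (σ t - t) * ↑(ha.unit⁻¹), ?_, map_vCoord σ hσ ha t, ?_⟩
  · rw [map_add, hr, map_mul, map_pow, hσϖ, map_uCoord σ hσ ha t]
  · have h1 : y = r + t * ϖ ^ j := by rw [ht]; ring
    have h2 := uCoord_add_vCoord_mul σ ha t
    rw [h1]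
    linear_combination (ϖ ^ j) * h2

include hσ ha in
/-- **`GL₂(F) = ⊔_j ι(E^×) diag(1, ϖ^j) GL₂(𝒪_F)` (existence, in coordinates)** — [Flicker1998UnitaryFL] REMARK p. 84 «`GL(V) = ⋃_{j≥0} E^× d_j K`» via MARS'
lemma: for a `σ`-FIXED `g ∈ M₂(R)` with `det g ≠ 0` there are `σ`-fixed `u v` (`z = u + v a ≠ 0`), `j ≥ 0`, and `σ`-fixed `U₀ U₁ W₀ W₁` with
`U₀W₁ − U₁W₀` a UNIT (`k = (U₀ U₁; W₀ W₁) ∈ GL₂(R^σ)`) such that, entrywise, **`g = ι(z) · diag(1, ϖ^j) · k`**: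
`g₀ᵢ = u·Uᵢ − v(aσa)·ϖ^j Wᵢ`, `g₁ᵢ = v·Uᵢ + (u + v(a+σa))·ϖ^j Wᵢ` (`i = 0, 1`); moreover the column lattice is `Λ_g = z·R_E(j)`:
`g₀ᵢ + g₁ᵢ a = z·(Uᵢ + ϖ^j Wᵢ a)`. [cite: Flicker1998UnitaryFL, REMARK p. 84; Prop. 6 p. 83] -/
theorem exists_coords_eq_iota_diag_pow {ϖ : R} (hϖ : Irreducible ϖ) (hσϖ : σ ϖ = ϖ) (g : Matrix (Fin 2) (Fin 2) R) (hg : ∀ i j, σ (g i j) = g i j)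
    (hdet : g 0 0 * g 1 1 - g 0 1 * g 1 0 ≠ 0) :
    ∃ (u v : R) (j : ℕ) (U₀ U₁ W₀ W₁ : R), σ u = u ∧ σ v = v ∧ u + v * a ≠ 0 ∧ σ U₀ = U₀ ∧ σ U₁ = U₁ ∧ σ W₀ = W₀ ∧ σ W₁ = W₁ ∧
      IsUnit (U₀ * W₁ - U₁ * W₀) ∧
      g 0 0 = u * U₀ - v * (a * σ a) * (ϖ ^ j * W₀) ∧ g 1 0 = v * U₀ + (u + v * (a + σ a)) * (ϖ ^ j * W₀) ∧
      g 0 1 = u * U₁ - v * (a * σ a) * (ϖ ^ j * W₁) ∧ g 1 1 = v * U₁ + (u + v * (a + σ a)) * (ϖ ^ j * W₁) := by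
  classical
  -- the two columns read in `R` and their `R^σ`-span
  set c₀ : R := g 0 0 + g 1 0 * a with hc₀
  set c₁ : R := g 0 1 + g 1 1 * a with hc₁
  let Λ : AddSubgroup R :=
    { carrier := {x | ∃ p q : R, σ p = p ∧ σ q = q ∧ x = p * c₀ + q * c₁}
      zero_mem' := ⟨0, 0, map_zero σ, map_zero σ, by ring⟩
      add_mem' := by
        rintro _ _ ⟨p, q, hp, hq, rfl⟩ ⟨p', q', hp', hq', rfl⟩
        exact ⟨p + p', q + q', by rw [map_add, hp, hp'], by rw [map_add, hq, hq'], by ring⟩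
      neg_mem' := by
        rintro _ ⟨p, q, hp, hq, rfl⟩
        exact ⟨-p, -q, by rw [map_neg, hp], by rw [map_neg, hq], by ring⟩ }
  have hΛ : ∀ x, x ∈ Λ ↔ ∃ p q : R, σ p = p ∧ σ q = q ∧ x = p * c₀ + q * c₁ := fun _ => Iff.rfl
  have hc₀Λ : c₀ ∈ Λ := ⟨1, 0, map_one σ, map_zero σ, by ring⟩
  have hc₁Λ : c₁ ∈ Λ := ⟨0, 1, map_zero σ, map_one σ, by ring⟩
  have hmul : ∀ r x, σ r = r → x ∈ Λ → r * x ∈ Λ := by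
    rintro r _ hr ⟨p, q, hp, hq, rfl⟩
    exact ⟨r * p, r * q, by rw [map_mul, hr, hp], by rw [map_mul, hr, hq], by ring⟩
  have hind : ∀ p q : R, σ p = p → σ q = q → p * c₀ + q * c₁ = 0 → p = 0 ∧ q = 0 :=
    fun p q hp hq h => coords_indep σ ha hg hdet hp hq h
  -- `Λ ≠ 0` and `Λ` is not of rank one
  have hne : ∃ x ∈ Λ, x ≠ 0 := by
    refine ⟨c₀, hc₀Λ, fun h0 => ?_⟩
    have := hind 1 0 (map_one σ) (map_zero σ) (by rw [h0]; ring)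
    exact one_ne_zero this.1
  have hrk : ¬ ∃ z : R, ∀ x ∈ Λ, ∃ r, σ r = r ∧ x = z * r := by
    rintro ⟨z, hz⟩
    obtain ⟨r₀, hr₀, h₀⟩ := hz c₀ hc₀Λ
    obtain ⟨r₁, hr₁, h₁⟩ := hz c₁ hc₁Λ
    have hrel : r₁ * c₀ + (-r₀) * c₁ = 0 := by rw [h₀, h₁]; ring
    obtain ⟨e₁, e₀⟩ := hind r₁ (-r₀) hr₁ (by rw [map_neg, hr₀]) hrel
    have hc0 : c₀ = 0 := by rw [h₀, neg_eq_zero.1 e₀, mul_zero]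
    exact one_ne_zero (hind 1 0 (map_one σ) (map_zero σ) (by rw [hc0]; ring)).1
  -- MARS
  obtain ⟨z, j, hzΛ, hz0, hΛz⟩ := exists_forall_mem_iff_exists_map_sub_self_mem_pow_and_eq_mul σ hσ ha Λ hmul hne hrk
  -- the columns in the basis `(z, z ϖ^j a)`
  obtain ⟨y₀, hy₀, hcy₀⟩ := (hΛz c₀).1 hc₀Λ
  obtain ⟨y₁, hy₁, hcy₁⟩ := (hΛz c₁).1 hc₁Λ
  obtain ⟨U₀, W₀, hU₀, hW₀, hyUW₀⟩ := exists_coords_of_map_sub_self_mem_pow σ hσ ha hϖ hσϖ hy₀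
  obtain ⟨U₁, W₁, hU₁, hW₁, hyUW₁⟩ := exists_coords_of_map_sub_self_mem_pow σ hσ ha hϖ hσϖ hy₁
  -- coordinates of `z`
  obtain ⟨v, hv⟩ : ∃ v : R, v = (σ z - z) * ↑(ha.unit⁻¹) := ⟨_, rfl⟩
  obtain ⟨u, hu⟩ : ∃ u : R, u = z - v * a := ⟨_, rfl⟩
  have hvσ : σ v = v := by rw [hv]; exact map_vCoord σ hσ ha z
  have huσ : σ u = u := by rw [hu, hv]; exact map_uCoord σ hσ ha z
  have hzuv : z = u + v * a := by rw [hu]; ring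
  have hσϖj : σ (ϖ ^ j) = ϖ ^ j := by rw [map_pow, hσϖ]
  -- entry identities: `c_i = z y_i = (u + v a)(U_i + (ϖ^j W_i) a)`
  have hcol : ∀ (g0 g1 Ui Wi : R), σ g0 = g0 → σ g1 = g1 → σ Ui = Ui → σ Wi = Wi →
      g0 + g1 * a = z * (Ui + ϖ ^ j * Wi * a) →
      g0 = u * Ui - v * (a * σ a) * (ϖ ^ j * Wi) ∧ g1 = v * Ui + (u + v * (a + σ a)) * (ϖ ^ j * Wi) := by
    intro g0 g1 Ui Wi h0 h1 hUi hWi hc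
    have hc' : g0 + g1 * a = (u * Ui - v * (a * σ a) * (ϖ ^ j * Wi)) + (v * Ui + (u + v * (a + σ a)) * (ϖ ^ j * Wi)) * a := by
      rw [hc, hzuv, ← mul_coords σ a u v Ui (ϖ ^ j * Wi)]
    refine coords_unique σ ha h0 h1 ?_ ?_ hc'
    · simp only [map_sub, map_mul, map_pow, huσ, hUi, hvσ, hWi, hσϖ, hσ, mul_comm (σ a) a]
    · simp only [map_add, map_mul, map_pow, huσ, hUi, hvσ, hWi, hσϖ, hσ, add_comm (σ a) a]
  have hg0 := hg 0 0; have hg1 := hg 1 0; have hg2 := hg 0 1; have hg3 := hg 1 1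
  obtain ⟨e00, e10⟩ := hcol (g 0 0) (g 1 0) U₀ W₀ hg0 hg1 hU₀ hW₀ (by rw [← hyUW₀, ← hcy₀])
  obtain ⟨e01, e11⟩ := hcol (g 0 1) (g 1 1) U₁ W₁ hg2 hg3 hU₁ hW₁ (by rw [← hyUW₁, ← hcy₁])
  -- `k ∈ GL₂(R^σ)`: `z` and `z ϖ^j a` lie in `Λ = span(c₀, c₁)`
  have hzaΛ : z * (ϖ ^ j * a) ∈ Λ := by
    refine (hΛz _).2 ⟨ϖ ^ j * a, ?_, rfl⟩
    have : σ (ϖ ^ j * a) - ϖ ^ j * a = ϖ ^ j * (σ a - a) := by rw [map_mul, hσϖj]; ring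
    rw [this, Irreducible.maximalIdeal_eq hϖ, Ideal.span_singleton_pow]
    exact Ideal.mul_mem_right _ _ (Ideal.mem_span_singleton_self _)
  obtain ⟨p₀, q₀, hp₀, hq₀, hzpq⟩ := (hΛ z).1 hzΛ
  obtain ⟨p₁, q₁, hp₁, hq₁, hzapq⟩ := (hΛ _).1 hzaΛ
  have hcz₀ : c₀ = U₀ * z + W₀ * (z * (ϖ ^ j * a)) := by rw [hcy₀, hyUW₀]; ring
  have hcz₁ : c₁ = U₁ * z + W₁ * (z * (ϖ ^ j * a)) := by rw [hcy₁, hyUW₁]; ring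
  have hrel₀ : (U₀ * p₀ + W₀ * p₁ - 1) * c₀ + (U₀ * q₀ + W₀ * q₁) * c₁ = 0 := by
    have := hcz₀; rw [hzapq, hzpq] at this; linear_combination -this
  have hrel₁ : (U₁ * p₀ + W₁ * p₁) * c₀ + (U₁ * q₀ + W₁ * q₁ - 1) * c₁ = 0 := by
    have := hcz₁; rw [hzapq, hzpq] at this; linear_combination -this
  obtain ⟨f₁, f₂⟩ := hind _ _ (by rw [map_sub, map_add, map_mul, map_mul, map_one, hU₀, hp₀, hW₀, hp₁])
    (by rw [map_add, map_mul, map_mul, hU₀, hq₀, hW₀, hq₁]) hrel₀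
  obtain ⟨f₃, f₄⟩ := hind _ _ (by rw [map_add, map_mul, map_mul, hU₁, hp₀, hW₁, hp₁])
    (by rw [map_sub, map_add, map_mul, map_mul, map_one, hU₁, hq₀, hW₁, hq₁]) hrel₁
  have hunit : IsUnit (U₀ * W₁ - U₁ * W₀) := by
    refine isUnit_iff_exists_inv.2 ⟨p₀ * q₁ - p₁ * q₀, ?_⟩
    linear_combination (U₁ * q₀ + W₁ * q₁) * f₁ + f₄ - (U₁ * p₀ + W₁ * p₁) * f₂
  have hz0' : u + v * a ≠ 0 := by rw [← hzuv]; exact hz0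
  exact ⟨u, v, j, U₀, U₁, W₀, W₁, huσ, hvσ, hz0', hU₀, hU₁, hW₀, hW₁, hunit, e00, e10, e01, e11⟩

/-! ## §3 (ED. 2) The multiplier order of `z·R_E(j)` and uniqueness of the exponent `j` -/

include hσ in
/-- **The multiplier ring of the lattice `Λ = z·R_E(j)` is `R_E(j)`** (`z ≠ 0`): `x·Λ ⊆ Λ ↔ σx − x ∈ 𝔪^j` — independent of `z`; this is the invariant
that separates the double cosets `ι(E^×)·d_j·GL₂(𝒪_F)`. [cite: Flicker1998UnitaryFL, REMARK p. 84] -/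
theorem forall_mul_mem_iff_map_sub_self_mem_pow {z : R} (hz : z ≠ 0) (j : ℕ) (x : R) :
    (∀ y : R, (∃ w, σ w - w ∈ maximalIdeal R ^ j ∧ y = z * w) → ∃ w, σ w - w ∈ maximalIdeal R ^ j ∧ x * y = z * w) ↔
      σ x - x ∈ maximalIdeal R ^ j := by
  constructor
  · intro h
    obtain ⟨w, hw, hxz⟩ := h z ⟨1, by rw [map_one, sub_self]; exact Ideal.zero_mem _, (mul_one z).symm⟩
    have hxw : x = w := mul_left_cancel₀ hz (by rw [← hxz, mul_comm])
    rwa [hxw]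
  · rintro hx y ⟨w, hw, rfl⟩
    exact ⟨x * w, map_sub_self_mem_pow_mul σ hσ j hx hw, by ring⟩

include hσ ha in
/-- **UNIQUENESS OF THE EXPONENT**: `z·R_E(j) = z′·R_E(j′)` (as subsets of `R`, `z ≠ 0`) forces `j = j′` — the multiplier orders agree, and the conductor
exponent of `R_E(j)` is unique (★ `eq_of_forall_map_sub_self_mem_pow_iff`).  Hence the index `j` in `g = ι(z)·diag(1,ϖ^j)·k` depends only on the
double coset `ι(E^×)·g·GL₂(𝒪_F)` (Flicker's disjointness in REMARK p. 84 ∕ Prop. 6 (b)). [cite: Flicker1998UnitaryFL, REMARK p. 84; Prop. 6 p. 83] -/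
theorem eq_of_lattice_eq {z z' : R} (hz : z ≠ 0) {j j' : ℕ}
    (h : ∀ y : R, (∃ w, σ w - w ∈ maximalIdeal R ^ j ∧ y = z * w) ↔ ∃ w, σ w - w ∈ maximalIdeal R ^ j' ∧ y = z' * w) : j = j' := by
  have hz' : z' ≠ 0 := by
    rintro rfl
    obtain ⟨w, -, hw⟩ := (h z).1 ⟨1, by rw [map_one, sub_self]; exact Ideal.zero_mem _, (mul_one z).symm⟩
    exact hz (by rw [hw, zero_mul])
  refine eq_of_forall_map_sub_self_mem_pow_iff σ hσ ha fun x => ?_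
  rw [← forall_mul_mem_iff_map_sub_self_mem_pow σ hσ hz j x, ← forall_mul_mem_iff_map_sub_self_mem_pow σ hσ hz' j' x]
  constructor
  · intro hx y hy
    exact (h _).1 (hx y ((h y).2 hy))
  · intro hx y hy
    exact (h _).2 (hx y ((h y).1 hy))

end Main

end Literature.NumberTheory.LocalFields.UnramifiedQuadraticNorm
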